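import Literature.MathematicalPhysics.QuantumFieldTheory.Balaban1983to89.Node00.Record5C
import Literature.MathematicalPhysics.QuantumFieldTheory.Balaban1983to89.Node00.Satisfiable
import Literature.MathematicalPhysics.QuantumFieldTheory.Balaban1983to89.B10Eq29TubeLine

/-!
# `Balaban1983to89.B10LeafUnpinnedRecord5C` — DAG node N08 · [Balaban1985UV3] at NODE 00's RECORD PREDICATE OF RECORD `Node00.IsRecordOfRecord₅C`
# (the C-binding, pub-ymgap chair R434 (Q2) = (C)): the [B10] run family is still a FREE residual field (`(θ.res.X P).runs10`), so N08 is UNDETERMINED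
# over the Stage-5 records — its leaf holds (degenerately) at every run of one record and FAILS at every run of another, where N08 then fails as soon as
# N03, N05, N06, N07 hold; the kernel form of «a B10-PINNING stage is required before `stub_N08` is typed over the record» (R422 ∕ R433), and the GLUE a
# pin consumes: N08 at `w.up P = upOfRecord₅C F N θ P` whenever `θ.res.X P` IS a tower-run carrier with leaf systems

B10 = T. Bałaban, *Ultraviolet stability of three-dimensional lattice pure gauge field theories*, Commun. Math. Phys. **102** (1985) 255–275 [Balaban1985UV3];
the record predicate is NODE 00's (`Node00.Record5C`, seat pub-ymgap-node00-def g28: `IsRecordOfRecord₅C F N D w := ∃ θ : Stage5Params F N, θ.Admissible ∧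
D = datumOfRecord₅ F N θ ∧ w.C = D.C ∧ w.γ = θ.γ ∧ w.L = θ.L ∧ ∀ P, w.up P = upOfRecord₅C F N θ P`, `upOfRecord₅C θ P = B10CompactBinding.ofPrintedAllXPNC
(carriers₃ θ (θ.res.X P)) (θ.res.Y P) (θ.res.Z P) (θ.res.V P) (θ.res.W P)`).  Seat `pub-ymgap-dag-n08-a` gen 2 (KNIT-BY-NAME; HUMAN RULING D-0062), companion
of the Summits-side knit `BalabanUVNodesN08Constructed` (p411652: N08 at the C-binding over the d = 3 lane's CONSTRUCTED run family from its (α) inputs) and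
of n06's `B9LeafUnpinnedRecord5` (the same probe for N06 at `Record5`, whose pattern §0 follows).  THEOREMS ONLY, def-free, sorry-free, standard axioms.

* §0 `exists_isRecordOfRecord₅C_b10_iff` — for EVERY four-torus family `F`, `N ≥ 1` and EVERY carrier bundle `Xc : PrintedCarriersR` there is a Stage-5
  record `(D, w)` (C-binding) with `(leavesP w P).b10 ↔ B10.Thm1PrintedCompact Xc.runs10 ∧ B10.Thm2Printed Xc.runs10` at every run: the residual field
  `Residual₅.X` is unconstrained and `carriers₃` does not touch the B10 group (`B10NodeKnit.carriers₃_groupB10`).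
* §1 `exists_isRecordOfRecord₅C_not_b10` — with `Xc :=` a bundle whose ONE run has `Ineq41_47 := False` (K = 0): a record at which the `b10` leaf FAILS
  at every run; there N08 fails as soon as N03, N06, N05, N07 hold (`b4`, `b5`, `b7` are theorems at every record: `Node00.b4∕b5∕b7_main_of_isRecordOfRecord₅C`);
  hence `not_K_nodes_over_record₅C`: the five nodes N03 ∧ N05 ∧ N06 ∧ N07 ∧ N08 cannot all be closed over `IsRecordOfRecord₅C` as it stands.
* §2 `exists_isRecordOfRecord₅C_b10` — with `Xc :=` the EMPTY run family: a record at which the `b10` leaf, hence N08, holds at every run (DEGENERATE —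
  vacuous truth; the non-degenerate positive statement is `BalabanUVNodesN08Constructed.b10_main_constructedLE_upC`, conditional on the (α) rows).
* §3 `b10_main_undetermined_over_record₅C` — the conjunction.  CONSEQUENCE (plan ∕ node00-def ∕ chair): a crux or stub reading «`∀ D w, IsRecordOfRecord₅C
  F N D w → ∀ P, Dag.B10_main (leavesP w P)`» is refutable as typed given its sister nodes, and its `∃`-dual is junk-provable; the [B10] group must be
  PINNED (`runs10` a function of genuine parameters — candidate of record: the d = 3 lane's constructed family, INBOX [N08-A-G2-FILED-T4]) first.
* §4 THE GLUE A PIN CONSUMES: `carriers₃_withTowerRuns10` (the Stage-3 substitutions commute with re-binding the B10 runs, `rfl`) and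
  `b10_main_of_upOfRecord₅C_of_leafSystems` ∕ `_of_slots`: N08 at any world bound by `upOfRecord₅C F N θ P` whose residual carrier `θ.res.X P` IS
  `Xc.withTowerRuns10 T` for tower runs carrying `B10Assembly.LeafSystem`s — `B10CompactBinding.b10_main_of_upC` transported along the two `rfl`s.
HONEST FRAMING: count-neutral; N08 NOT discharged; nothing asserted about [B10] at Bałaban's objects; the §1∕§2 carriers are DEGENERATE probes, not
objects of record; one finite T⁴ programme at fixed ε; nothing continuum ∕ ℝ⁴ ∕ OS ∕ mass-gap ∕ Clay.

EDITION 2026-08-29 (director-ym №268 (4), SECOND RING of the record-abelian repair FLAG №14): the ∃-witness literal of `exists_isRecordOfRecord₅C_b10_iff` re-keyed from the scalar placeholder `𝔸 := ℂ` to the record carrier `𝔸 := Matrix (Fin 2) (Fin 2) ℂ` (C⋆-structure `B10Eq29TubeLine.cstarAlgebraMatrix 2`, the carrier of `Node00.stage3OfRecord₁₂` since the FLAG №14 edition of `Node00.Record12Numerics`); the proofs are carrier-blind and NO statement changes (none of them exposes `𝔸`); one import added (`B10Eq29TubeLine`, cycle-free); count-neutral bookkeeping, nothing continuum ∕ OS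 ∕ mass-gap.
-/

noncomputable section

namespace Literature.MathematicalPhysics.QuantumFieldTheory.Balaban1983to89.B10LeafUnpinnedRecord5C

open DagBinding DagDischargedII
open B10 (RunData TowerRun Thm1Printed Thm2Printed Thm1PrintedCompact)
open B10Assembly (LeafSystem)
open DagDischarged (b10Compact)
open B10CompactBinding (ofPrintedAllXPNC)

variable (F : T4Continuum.T4Family) (N : ℕ) [NeZero N]

/-! ## §0 A Stage-5 record (C-binding) around an arbitrary carrier bundle -/

/-- **Every carrier bundle occurs as the residual `X` of some Stage-5 record (C-binding)**: for any `Xc` there is `(D, w)` with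
`Node00.IsRecordOfRecord₅C F N D w` and `(leavesP w P).b10 ↔ Thm1PrintedCompact Xc.runs10 ∧ Thm2Printed Xc.runs10` at every run (the residual field
`Residual₅.X` is unconstrained, `carriers₃` keeps the B10 group; the other residual objects are the trivial ones, the Stage-3 parameters those of
`B9LeafUnpinnedRecord5` §0, `γ := 1`). [cite: Balaban1985UV3, Thm 1 p.257 (compact reading) + Thm 2 p.272 (bookkeeping over NODE 00's Stage-5 record predicate)] -/
theorem exists_isRecordOfRecord₅C_b10_iff (Xc : PrintedCarriersR) :
    ∃ (D : T4Continuum.FiniteEpsData F (Node00.SU N)) (w : WorldP), Node00.IsRecordOfRecord₅C F N D w ∧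
      ∀ P : B12.RunParams, ((leavesP w P).b10 ↔ Thm1PrintedCompact Xc.runs10 ∧ Thm2Printed Xc.runs10) := by
  obtain ⟨θ, hθ, hD⟩ := Node00.Stage1Params.exists_admissible
  obtain ⟨Y⟩ := Node00.nonempty_printedCarriers9X
  obtain ⟨Z⟩ := Node00.nonempty_printedCarriers11
  obtain ⟨V⟩ := Node00.nonempty_printedCarriers14R
  obtain ⟨W⟩ := Node00.nonempty_printedCarriers15
  obtain ⟨w₀⟩ := Node00.nonempty_worldP
  have hL1 : 1 ≤ θ.L := le_of_lt θ.hL.2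
  have hℓ : (θ.L - 1 : ℕ) + 1 = θ.L := Nat.sub_add_cancel hL1
  let θ₃ : Node00.Stage3Params :=
    { θ with
      𝔸 := Matrix (Fin 2) (Fin 2) ℂ, instCStar := B10Eq29TubeLine.cstarAlgebraMatrix 2, instNontrivial := inferInstance, d₆ := 3, ℓ₆ := θ.L - 1, hd₆ := by rw [hD], hℓ₆ := hℓ, b₀ := 1, b₁ := 1, hb := ⟨one_pos, le_rfl⟩
      δ₀ := 2 / (((θ.L - 1 : ℕ) : ℝ) + 1), hδ₀ := ⟨by positivity, le_rfl⟩ }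
  let res : Node00.Residual₅ F N :=
    { X := fun _ => Xc, Y := fun _ => Y, Z := fun _ => Z, V := fun _ => V, W := fun _ => W, βfun := fun _ _ => 0, E := fun _ => 0,
      dom := fun _ _ => ∅, effAction := fun _ _ _ => 0, wilsonBG := fun _ _ _ => 0, Ek := fun _ _ _ => 0, χ := fun _ _ _ => 0,
      S218 := fun _ _ _ => False, ReprA := fun _ _ _ _ _ _ _ => False, IndA := fun _ _ _ _ _ _ _ => False, R := fun _ _ => id,
      preservesIntegral_R := fun _ _ _ _ => rfl, integrable_R := fun _ _ _ _ h => h }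
  let θ₅ : Node00.Stage5Params F N := { θ₃ with γ := 1, res := res }
  have hθ₅ : θ₅.Admissible := ⟨hθ, one_pos⟩
  let w : WorldP :=
    { w₀ with
      C := (Node00.datumOfRecord₅ F N θ₅).C, γ := θ₅.γ, L := (θ₅.L : ℝ), one_lt_L := by exact_mod_cast θ.hL.2
      up := fun P => Node00.upOfRecord₅C F N θ₅ P }
  exact ⟨Node00.datumOfRecord₅ F N θ₅, w, Node00.isRecordOfRecord₅C_of_eq F N θ₅ hθ₅ w rfl rfl rfl (fun _ => rfl), fun _ => Iff.rfl⟩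

/-! ## §1 The `b10` leaf FAILS at some Stage-5 record; there N08 fails given its sister nodes -/

/-- **At some Stage-5 record (C-binding) the `b10` leaf FAILS at every run**: the record of §0 around a DEGENERATE bundle with ONE [B10] run whose
(41)∕(47) slot is `False` (`K = 0`), so `Thm2Printed` fails at `k = 0`.  A probe of the TYPING over the residual field, not a statement about Bałaban's
densities. [cite: Balaban1985UV3, Thm 2 p.272 (bookkeeping: the typed leaf over a degenerate residual run family)] -/
theorem exists_isRecordOfRecord₅C_not_b10 :
    ∃ (D : T4Continuum.FiniteEpsData F (Node00.SU N)) (w : WorldP), Node00.IsRecordOfRecord₅C F N D w ∧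
      ∀ P : B12.RunParams, ¬ (leavesP w P).b10 := by
  obtain ⟨X₀⟩ := Node00.nonempty_printedCarriersR
  obtain ⟨D, w, hrec, hb10⟩ := exists_isRecordOfRecord₅C_b10_iff F N
    { X₀ with
      I10 := PUnit
      runs10 := fun _ =>
        { K := 0, Cfg := fun _ => PUnit, ρ := fun _ _ => 0, χ := fun _ _ => 0, wilsonBG := fun _ _ => 0, sites := fun _ => 0,
          g := fun _ => 0, Ineq41_47 := fun _ => False } }
  exact ⟨D, w, hrec, fun P h => ((hb10 P).1 h).2 PUnit.unit 0 le_rfl⟩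

/-- **Hence, at that record, N08 FAILS as soon as N03, N06, N05, N07 hold there** (`b4`, `b5`, `b7` hold at every Stage-5 record —
`Node00.b4∕b5∕b7_main_of_isRecordOfRecord₅C` — so the four sister nodes supply `b6`, `b8`, `b9`, `b11`, and `Dag.B10_main` would force the false leaf).
[cite: Balaban1985UV3, Thm 1 p.257 + Thm 2 p.272 (bookkeeping over the node shape `Dag.B10_main`)] -/
theorem exists_isRecordOfRecord₅C_sisters_imp_not_b10_main :
    ∃ (D : T4Continuum.FiniteEpsData F (Node00.SU N)) (w : WorldP), Node00.IsRecordOfRecord₅C F N D w ∧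
      ∀ P : B12.RunParams, Dag.B6_main (leavesP w P) → Dag.B9_main (leavesP w P) → Dag.B8_main (leavesP w P) →
        Dag.B11_main (leavesP w P) → ¬ Dag.B10_main (leavesP w P) := by
  obtain ⟨D, w, hrec, hb10⟩ := exists_isRecordOfRecord₅C_not_b10 F N
  refine ⟨D, w, hrec, fun P h6 h9 h8 h11 h10 => hb10 P ?_⟩
  have h4 : (leavesP w P).b4 := Node00.b4_main_of_isRecordOfRecord₅C hrec P
  have h5 : (leavesP w P).b5 := Node00.b5_main_of_isRecordOfRecord₅C hrec P h4
  have h7 : (leavesP w P).b7 := Node00.b7_main_of_isRecordOfRecord₅C hrec P h5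
  have h6' : (leavesP w P).b6 := h6 h4 h5
  have h9' : (leavesP w P).b9 := h9 h4 h5 h6' h7
  have h8' : (leavesP w P).b8 := h8 h5 h6' h7 h9'
  have h11' : (leavesP w P).b11 := h11 h5 h6' h7 h8' h9'
  exact h10 h5 h6' h7 h8' h9' h11'

/-- **So the Stage-5 record predicate (C-binding) cannot carry N03 ∧ N05 ∧ N06 ∧ N07 ∧ N08 at all its records** as it stands — the B10 group must be
pinned first (R422 «definition first» ∕ the chair's rev-1 soundness test R433). [cite: Balaban1985UV3, Thm 1 p.257 + Thm 2 p.272 (bookkeeping)] -/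
theorem not_K_nodes_over_record₅C :
    ¬ ∀ (D : T4Continuum.FiniteEpsData F (Node00.SU N)) (w : WorldP), Node00.IsRecordOfRecord₅C F N D w →
      ∀ P : B12.RunParams, Dag.B6_main (leavesP w P) ∧ Dag.B8_main (leavesP w P) ∧ Dag.B9_main (leavesP w P) ∧
        Dag.B11_main (leavesP w P) ∧ Dag.B10_main (leavesP w P) := by
  obtain ⟨D, w, hrec, h⟩ := exists_isRecordOfRecord₅C_sisters_imp_not_b10_main F N
  intro hall
  obtain ⟨h6, h8, h9, h11, h10⟩ := hall D w hrec ⟨0, 0, 0⟩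
  exact h ⟨0, 0, 0⟩ h6 h9 h8 h11 h10

/-- **Were N03, N05, N06, N07 closed over the Stage-5 records, N08 would be REFUTABLE over them** — the sharp form of «`stub_N08` must not be typed over
`IsRecordOfRecord₅C` before the B10-pin stage». [cite: Balaban1985UV3, Thm 1 p.257 + Thm 2 p.272 (bookkeeping)] -/
theorem not_b10_main_over_record₅C_of_sisters
    (h6 : ∀ (D : T4Continuum.FiniteEpsData F (Node00.SU N)) (w : WorldP), Node00.IsRecordOfRecord₅C F N D w →
      ∀ P : B12.RunParams, Dag.B6_main (leavesP w P))
    (h9 : ∀ (D : T4Continuum.FiniteEpsData F (Node00.SU N)) (w : WorldP), Node00.IsRecordOfRecord₅C F N D w →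
      ∀ P : B12.RunParams, Dag.B9_main (leavesP w P))
    (h8 : ∀ (D : T4Continuum.FiniteEpsData F (Node00.SU N)) (w : WorldP), Node00.IsRecordOfRecord₅C F N D w →
      ∀ P : B12.RunParams, Dag.B8_main (leavesP w P))
    (h11 : ∀ (D : T4Continuum.FiniteEpsData F (Node00.SU N)) (w : WorldP), Node00.IsRecordOfRecord₅C F N D w →
      ∀ P : B12.RunParams, Dag.B11_main (leavesP w P)) :
    ¬ ∀ (D : T4Continuum.FiniteEpsData F (Node00.SU N)) (w : WorldP), Node00.IsRecordOfRecord₅C F N D w →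
      ∀ P : B12.RunParams, Dag.B10_main (leavesP w P) := by
  obtain ⟨D, w, hrec, h⟩ := exists_isRecordOfRecord₅C_sisters_imp_not_b10_main F N
  exact fun hall => h ⟨0, 0, 0⟩ (h6 D w hrec _) (h9 D w hrec _) (h8 D w hrec _) (h11 D w hrec _) (hall D w hrec _)

/-! ## §2 The `b10` leaf HOLDS at some Stage-5 record (degenerate: the empty run family) -/

/-- **At some Stage-5 record (C-binding) the `b10` leaf — hence N08 — holds at every run**: the record of §0 around a bundle with NO [B10] run
(`I10 := PEmpty`), where `Thm1PrintedCompact` and `Thm2Printed` hold vacuously.  DEGENERATE on purpose (ref-C READ #4 (A1): a pin to an empty family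
is vacuity); the non-degenerate positive statement is `BalabanUVNodesN08Constructed.b10_main_constructedLE_upC` (conditional on the d = 3 lane's (α)
rows). [cite: Balaban1985UV3, Thm 1 p.257 (compact reading) + Thm 2 p.272 (bookkeeping: vacuous truth over the empty run family)] -/
theorem exists_isRecordOfRecord₅C_b10 :
    ∃ (D : T4Continuum.FiniteEpsData F (Node00.SU N)) (w : WorldP), Node00.IsRecordOfRecord₅C F N D w ∧
      ∀ P : B12.RunParams, (leavesP w P).b10 ∧ Dag.B10_main (leavesP w P) := by
  obtain ⟨X₀⟩ := Node00.nonempty_printedCarriersR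
  obtain ⟨D, w, hrec, hb10⟩ := exists_isRecordOfRecord₅C_b10_iff F N { X₀ with I10 := PEmpty, runs10 := fun i => nomatch i }
  have hleaf : ∀ P, (leavesP w P).b10 := fun P =>
    (hb10 P).2 ⟨fun _ _ _ _ => ⟨0, fun i => nomatch i⟩, fun i => nomatch i⟩
  exact ⟨D, w, hrec, fun P => ⟨hleaf P, B10NodeKnit.b10_main_of_leaf (hleaf P)⟩⟩

/-! ## §3 N08 is undetermined over the Stage-5 record predicate of record -/

/-- **N08 is UNDETERMINED over NODE 00's Stage-5 records (C-binding)**: it holds at every run of one record (§2) and fails — given N03, N05, N06, N07 —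
at every run of another (§1).  Neither «`∀ D w, IsRecordOfRecord₅C F N D w → ∀ P, Dag.B10_main (leavesP w P)`» nor its `∃`-dual carries content; the
[B10] group must be pinned as a function of genuine parameters before N08 is typed over a record (§4 is the shape the pin consumes).
[cite: Balaban1985UV3, Thm 1 p.257 + Thm 2 p.272 (bookkeeping: independence of the typed node over the Stage-5 record predicate)] -/
theorem b10_main_undetermined_over_record₅C :
    (∃ (D : T4Continuum.FiniteEpsData F (Node00.SU N)) (w : WorldP), Node00.IsRecordOfRecord₅C F N D w ∧
      ∀ P : B12.RunParams, Dag.B10_main (leavesP w P)) ∧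
    (∃ (D : T4Continuum.FiniteEpsData F (Node00.SU N)) (w : WorldP), Node00.IsRecordOfRecord₅C F N D w ∧
      ∀ P : B12.RunParams, Dag.B6_main (leavesP w P) → Dag.B9_main (leavesP w P) → Dag.B8_main (leavesP w P) →
        Dag.B11_main (leavesP w P) → ¬ Dag.B10_main (leavesP w P)) := by
  obtain ⟨D, w, hrec, h⟩ := exists_isRecordOfRecord₅C_b10 F N
  exact ⟨⟨D, w, hrec, fun P => (h P).2⟩, exists_isRecordOfRecord₅C_sisters_imp_not_b10_main F N⟩

/-! ## §4 The glue a B10-pin consumes: N08 at `upOfRecord₅C` when the residual carrier IS a tower-run carrier with leaf systems -/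

variable {F N}

/-- **The Stage-3 substitutions commute with re-binding the B10 runs** (`carriers₃` touches the B4 ∕ B5 ∕ B6 ∕ B7 groups only; `rfl`).
[cite: Balaban1984PropagatorsII, pp.223–250 (the Stage-3 carriers of record; bookkeeping)] -/
theorem carriers₃_withTowerRuns10 (θ : Node00.Stage3Params) (Xc : PrintedCarriersR) {I : Type} (T : I → TowerRun) :
    Node00.carriers₃ θ (Xc.withTowerRuns10 T) = (Node00.carriers₃ θ Xc).withTowerRuns10 T := rfl

/-- **The C-binding of record over a tower-run residual carrier, unfolded**: if `θ.res.X P = Xc.withTowerRuns10 T` then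
`upOfRecord₅C F N θ P = ofPrintedAllXPNC ((carriers₃ θ Xc).withTowerRuns10 T) (θ.res.Y P) (θ.res.Z P) (θ.res.V P) (θ.res.W P)` — the shape
`B10CompactBinding.b10_main_of_upC` consumes. [cite: Balaban1985UV3, Thm 1 p.257 (compact reading; bookkeeping)] -/
theorem upOfRecord₅C_eq_of_towerRuns (θ : Node00.Stage5Params F N) (P : B12.RunParams) (Xc : PrintedCarriersR) {I : Type}
    (T : I → TowerRun) (hX : θ.res.X P = Xc.withTowerRuns10 T) :
    Node00.upOfRecord₅C F N θ P =
      ofPrintedAllXPNC ((Node00.carriers₃ θ.toStage3Params Xc).withTowerRuns10 T) (θ.res.Y P) (θ.res.Z P) (θ.res.V P) (θ.res.W P) := by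
  rw [Node00.upOfRecord₅C_eq, hX]
  rfl

/-- **N08 AT A WORLD BOUND BY THE C-BINDING OF RECORD, FROM LEAF SYSTEMS ON THE RESIDUAL TOWER RUNS**: if `w.up P = upOfRecord₅C F N θ P` and the residual
carrier at `P` IS `Xc.withTowerRuns10 T` for tower runs carrying `B10Assembly.LeafSystem`s with common constants, then `Dag.B10_main (leavesP w P)`
(in-edges unused) — `B10CompactBinding.b10_main_of_upC` along `upOfRecord₅C_eq_of_towerRuns`.  What a NODE 00 stage pinning `Residual₅.X`'s B10 group to
genuine towers instantiates (the d = 3 lane's constructed family: `BalabanUVNodesN08Constructed`, leaf systems from its (α) rows). [cite: Balaban1985UV3, Thm 1 p.257 (compact reading) + Thm 2 p.272] -/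
theorem b10_main_of_upOfRecord₅C_of_leafSystems (θ : Node00.Stage5Params F N) {w : WorldP} {P : B12.RunParams}
    (hup : w.up P = Node00.upOfRecord₅C F N θ P) (Xc : PrintedCarriersR) {I : Type} {C : B10Assembly.Consts} {T : I → TowerRun}
    (S : ∀ i, LeafSystem C (T i)) (hX : θ.res.X P = Xc.withTowerRuns10 T) : Dag.B10_main (leavesP w P) :=
  B10CompactBinding.b10_main_of_upC S (hup.trans (upOfRecord₅C_eq_of_towerRuns θ P Xc T hX))

/-- **The same over the record predicate, in the «slots» shape** (`B14NodeKnitRecord5` ∕ `B16NodeKnitRecord5`): if for every admissible `θ` whose C-binding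
binds `w`, at every run the residual carrier is a tower-run carrier with leaf systems, then N08 holds at every run of the record.  (For the Stage-5
predicate AS IT STANDS the hypothesis is not dischargeable — `θ.res.X` is free, §1; it is the obligation a B10-pin stage turns into a definition + the
(α) rows.) [cite: Balaban1985UV3, Thm 1 p.257 (compact reading) + Thm 2 p.272 (bookkeeping shape)] -/
theorem b10_main_of_isRecordOfRecord₅C_of_slots {D : T4Continuum.FiniteEpsData F (Node00.SU N)} {w : WorldP}
    (h : Node00.IsRecordOfRecord₅C F N D w)
    (slots : ∀ θ : Node00.Stage5Params F N, θ.Admissible → D = Node00.datumOfRecord₅ F N θ →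
      (∀ P, w.up P = Node00.upOfRecord₅C F N θ P) → ∀ P : B12.RunParams,
        ∃ (Xc : PrintedCarriersR) (I : Type) (C : B10Assembly.Consts) (T : I → TowerRun),
          Nonempty (∀ i, LeafSystem C (T i)) ∧ θ.res.X P = Xc.withTowerRuns10 T) :
    ∀ P : B12.RunParams, Dag.B10_main (leavesP w P) := by
  intro P
  obtain ⟨θ, hθ, hD, -, -, -, hup⟩ := h
  obtain ⟨Xc, I, C, T, ⟨S⟩, hX⟩ := slots θ hθ hD hup P
  exact b10_main_of_upOfRecord₅C_of_leafSystems θ (hup P) Xc S hX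

end Literature.MathematicalPhysics.QuantumFieldTheory.Balaban1983to89.B10LeafUnpinnedRecord5C

end
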